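import Summits.AtomisticToContinuum.FouriersLaw.Theorems.VanishingNoiseTransferVanishingNoiseBoundFlipDualKuboLink
import Summits.AtomisticToContinuum.FouriersLaw.Theorems.VanishingNoiseTransferNoisyFourierFlipCeilingBondResponse
import Summits.AtomisticToContinuum.FouriersLaw.Theorems.VanishingNoiseTransferNoisyFourierFlipCeilingDissipation
import Summits.AtomisticToContinuum.FouriersLaw.Theorems.VanishingNoiseTransferNoisyFourierFlipCeilingGibbsMoment
import Summits.AtomisticToContinuum.FouriersLaw.Theorems.OddResponseBound.Negative.OddPairing

/-!
# The response ceiling of the flip chain, I: the field ceiling from the three registered helpers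

Helper development for crux `NoisyFourier` (stmt-AtomisticToContinuum-11977, route `VanishingNoiseTransfer`),
line `sector-dirichlet-gluing`, registered stub `stub_flipConductanceCeiling` (reshape c1): the finite-length
response coefficients `D_N(ε)` of the velocity-flip pinned anharmonic chain are bounded uniformly in `N`.
By the landed Kubo link (`VanishingNoiseBound.flip_kuboLink_of_dualForwardFields`)
`D_L/(L−1) = γ(1 − (γ/T²)A)`, `A = ⟨g, p_0² − T⟩_{μ_T}`, for the classical equilibrium forward field `g`
(`(L_{T,T} + εS) g = −(p_0² − T)`, `g ∈ C² ∩ L²(μ_T)`), so the stub is the FIELD CEILING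
`(L−1)·γ(1 − (γ/T²)A) ≤ K` proved here from three registered helpers taken as hypotheses (landed separately):
(a) `helper_flipBondResponseIdentity` — every bond carries the response, `⟨g, j_i⟩ = γA − T²`;
(b) `helper_flipFieldDissipationLe` — the flip dissipation of the field is at most `B̂ = T²/γ − A`:
`(ε/2)Σ_i‖g∘F_i − g‖² ≤ B̂`; (c) `helper_gibbsHalfCurrentSqLe` — the two halves `p_i V′(r_i)`, `p_{i+1}V′(r_i)`
of a bond current have `L²(μ_T)` norms bounded by `M` uniformly in the length. Mechanism (Bernardin–Olla 2011 §3,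
entropy production): each half current is odd under ONE velocity flip, so `(γB̂)² = ⟨g, j_i⟩² ≤ (M/8)(d_i + d_{i+1})`
with `d_k = ‖g∘F_k − g‖²` (`sq_integral_mul_le_of_odd`); summing over the `L − 1` bonds,
`(L−1)γ²B̂² ≤ (M/4)Σ_k d_k ≤ (M/2ε)B̂`, whence `(L−1)(γ²/T²)B̂ ≤ M/(2εT²)` (`fieldCeiling_of`). No definitions.
-/

noncomputable section

open MeasureTheory Filter Topology Finset

namespace Summit.AtomisticToContinuum.FouriersLaw.Theorems.NoisyFourier.FlipCeiling

open Literature.MathematicalPhysics.KineticTheory.HeatConduction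
open Summit.AtomisticToContinuum.FouriersLaw.Theorems.SuperadditiveResistance.DeviceLiouville (kin)

/-- **Pairing with an observable odd under one velocity flip.** If `μ` is invariant under the flip
`F_i`, `g, a ∈ L²(μ)` and `a ∘ F_i = −a`, then `(∫ g a dμ)² ≤ ¼ (∫ (g∘F_i − g)² dμ)(∫ a² dμ)`:
`2∫ g a = ∫ (g − g∘F_i) a` and Cauchy–Schwarz. [folklore] -/
theorem sq_integral_mul_le_of_odd {L : ℕ} {μ : Measure (PhaseSpace L)} {i : Fin L}
    (hμ : MeasurePreserving (momentumFlip i) μ μ) {g a : PhaseSpace L → ℝ}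
    (hg : MemLp g 2 μ) (ha : MemLp a 2 μ) (hodd : ∀ x, a (momentumFlip i x) = -a x) :
    (∫ x, g x * a x ∂μ) ^ 2 ≤
      1 / 4 * (∫ x, (g (momentumFlip i x) - g x) ^ 2 ∂μ) * ∫ x, a x ^ 2 ∂μ := by
  have hgF : MemLp (fun x => g (momentumFlip i x)) 2 μ := hg.comp_measurePreserving hμ
  have hflip : ∫ x, g (momentumFlip i x) * a x ∂μ = -∫ x, g x * a x ∂μ := by
    rw [← integral_mul_comp_momentumFlip hμ a g, ← integral_neg]
    refine integral_congr_ae (Eventually.of_forall fun x => ?_)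
    simp only [hodd x, mul_neg]
  have hdiff : ∫ x, (g (momentumFlip i x) - g x) * a x ∂μ = -2 * ∫ x, g x * a x ∂μ := by
    have e : (fun x => (g (momentumFlip i x) - g x) * a x) =
        fun x => g (momentumFlip i x) * a x - g x * a x := by
      funext x; ring
    have i1 : Integrable (fun x => g (momentumFlip i x) * a x) μ := hgF.integrable_mul ha
    have i2 : Integrable (fun x => g x * a x) μ := hg.integrable_mul ha
    rw [e, integral_sub i1 i2, hflip]
    ring
  have hcs := OddResponseBound.Negative.OddPairing.sq_integral_mul_le (hgF.sub hg) ha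
  have e2 : (∫ x, (fun x => g (momentumFlip i x)) x - g x ∂μ) = ∫ x, g (momentumFlip i x) - g x ∂μ := rfl
  have key : (-2 * ∫ x, g x * a x ∂μ) ^ 2 ≤
      (∫ x, (g (momentumFlip i x) - g x) ^ 2 ∂μ) * ∫ x, a x ^ 2 ∂μ := by
    rw [← hdiff]
    simpa only [Pi.sub_apply] using hcs
  nlinarith [key]

/-- **The field ceiling from the three registered helpers.** For all admissible parameters, `T > 0` and
`ε > 0` there is `K` (namely `M/(2εT²)`, `M` the uniform half-current bound of helper (c)) such that for every
`L ≥ 2` and every classical `C² ∩ L²(μ_T)` forward field `g` of `L_{T,T} + εS` with source `−(p_0² − T)`: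
`(L − 1)·γ(1 − (γ/T²)⟨g, p_0² − T⟩_{μ_T}) ≤ K`. See the module docstring for the argument.
[cite: BernardinOlla2011, §3] -/
theorem fieldCeiling_of
    (hA : ∀ (ω₂ lam β γ T ε : ℝ), 0 < ω₂ → 0 < lam → 0 < β → 0 < γ → 0 < T → ∀ (L : ℕ), 2 ≤ L → ∀ g : Literature.MathematicalPhysics.KineticTheory.HeatConduction.PhaseSpace L → ℝ, ContDiff ℝ 2 g → MeasureTheory.MemLp g 2 ((Literature.MathematicalPhysics.KineticTheory.HeatConduction.pinnedChain ω₂ lam β γ).gibbsMeasure L T) → (∀ x, (Literature.MathematicalPhysics.KineticTheory.HeatConduction.pinnedChain ω₂ lam β γ).flipGenerator L T T ε g x = -(Summit.AtomisticToContinuum.FouriersLaw.Theorems.SuperadditiveResistance.DeviceLiouville.kin L 0 x - T)) → ∀ (i : Fin L), i.val + 1 < L → MeasureTheory.integral ((Literature.MathematicalPhysics.KineticTheory.HeatConduction.pinnedChain ω₂ lam β γ).gibbsMeasure L T) (fun x => g x * (Literature.MathematicalPhysics.KineticTheory.HeatConduction.pinnedChain ω₂ lam β γ).bondCurrent L i x)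 = γ * MeasureTheory.integral ((Literature.MathematicalPhysics.KineticTheory.HeatConduction.pinnedChain ω₂ lam β γ).gibbsMeasure L T) (fun x => g x * (Summit.AtomisticToContinuum.FouriersLaw.Theorems.SuperadditiveResistance.DeviceLiouville.kin L 0 x - T)) - T ^ 2)
    (hB : ∀ (ω₂ lam β γ T ε : ℝ), 0 < ω₂ → 0 < lam → 0 < β → 0 < γ → 0 < T → ∀ (L : ℕ), 2 ≤ L → ∀ g : Literature.MathematicalPhysics.KineticTheory.HeatConduction.PhaseSpace L → ℝ, ContDiff ℝ 2 g → MeasureTheory.MemLp g 2 ((Literature.MathematicalPhysics.KineticTheory.HeatConduction.pinnedChain ω₂ lam β γ).gibbsMeasure L T) → (∀ x, (Literature.MathematicalPhysics.KineticTheory.HeatConduction.pinnedChain ω₂ lam β γ).flipGenerator L T T ε g x = -(Summit.AtomisticToContinuum.FouriersLaw.Theorems.SuperadditiveResistance.DeviceLiouville.kin L 0 x - T)) → ε / 2 * ∑ i : Fin L, MeasureTheory.integral ((Literature.MathematicalPhysics.KineticTheory.HeatConduction.pinnedChain ω₂ lam β γ).gibbsMeasure L T) (fun x => (g (Literature.MathematicalPhysics.KineticTheory.HeatConduction.momentumFlip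 i x) - g x) ^ 2) ≤ T ^ 2 / γ - MeasureTheory.integral ((Literature.MathematicalPhysics.KineticTheory.HeatConduction.pinnedChain ω₂ lam β γ).gibbsMeasure L T) (fun x => g x * (Summit.AtomisticToContinuum.FouriersLaw.Theorems.SuperadditiveResistance.DeviceLiouville.kin L 0 x - T)))
    (hC : ∀ (ω₂ lam β γ T : ℝ), 0 < ω₂ → 0 < lam → 0 < β → 0 < T → ∃ M : ℝ, ∀ (L : ℕ) (i j : Fin L), j.val = i.val + 1 → (MeasureTheory.MemLp (fun x : Literature.MathematicalPhysics.KineticTheory.HeatConduction.PhaseSpace L => x.2 i * deriv (Literature.MathematicalPhysics.KineticTheory.HeatConduction.pinnedChain ω₂ lam β γ).V (x.1 j - x.1 i)) 2 ((Literature.MathematicalPhysics.KineticTheory.HeatConduction.pinnedChain ω₂ lam β γ).gibbsMeasure L T) ∧ MeasureTheory.integral ((Literature.MathematicalPhysics.KineticTheory.HeatConduction.pinnedChain ω₂ lam β γ).gibbsMeasure L T) (fun x => (x.2 i * deriv (Literature.MathematicalPhysics.KineticTheory.HeatConduction.pinnedChain ω₂ lam β γ).V (x.1 j - x.1 i)) ^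 2) ≤ M) ∧ (MeasureTheory.MemLp (fun x : Literature.MathematicalPhysics.KineticTheory.HeatConduction.PhaseSpace L => x.2 j * deriv (Literature.MathematicalPhysics.KineticTheory.HeatConduction.pinnedChain ω₂ lam β γ).V (x.1 j - x.1 i)) 2 ((Literature.MathematicalPhysics.KineticTheory.HeatConduction.pinnedChain ω₂ lam β γ).gibbsMeasure L T) ∧ MeasureTheory.integral ((Literature.MathematicalPhysics.KineticTheory.HeatConduction.pinnedChain ω₂ lam β γ).gibbsMeasure L T) (fun x => (x.2 j * deriv (Literature.MathematicalPhysics.KineticTheory.HeatConduction.pinnedChain ω₂ lam β γ).V (x.1 j - x.1 i)) ^ 2) ≤ M)) :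
    ∀ (ω₂ lam β γ T ε : ℝ), 0 < ω₂ → 0 < lam → 0 < β → 0 < γ → 0 < T → 0 < ε → ∃ K : ℝ,
      ∀ (L : ℕ), 2 ≤ L → ∀ g : PhaseSpace L → ℝ, ContDiff ℝ 2 g →
        MemLp g 2 ((pinnedChain ω₂ lam β γ).gibbsMeasure L T) →
        (∀ x, (pinnedChain ω₂ lam β γ).flipGenerator L T T ε g x = -(kin L 0 x - T)) →
        ((L : ℝ) - 1) * (γ * (1 - γ / T ^ 2 *
          ∫ x, g x * (kin L 0 x - T) ∂((pinnedChain ω₂ lam β γ).gibbsMeasure L T))) ≤ K := by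
  intro ω₂ lam β γ T ε hω hl hβ hγ hT hε
  obtain ⟨M, hM⟩ := hC ω₂ lam β γ T hω hl hβ hT
  -- `M ≥ 0` from the instance `L = 2`
  have hM0 : 0 ≤ M := by
    have h := (hM 2 ⟨0, by norm_num⟩ ⟨1, by norm_num⟩ rfl).1.2
    exact (integral_nonneg fun x => sq_nonneg _).trans h
  refine ⟨M / (2 * ε * T ^ 2), fun L hL g hg2 hgL hpde => ?_⟩
  set P := pinnedChain ω₂ lam β γ with hP
  set μ := P.gibbsMeasure L T with hμ
  set A := ∫ x, g x * (kin L 0 x - T) ∂μ with hAdef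
  set Bh := T ^ 2 / γ - A with hBh
  -- the flip dissipation
  set d : Fin L → ℝ := fun k => ∫ x, (g (momentumFlip k x) - g x) ^ 2 ∂μ with hd
  have hd0 : ∀ k, 0 ≤ d k := fun k => integral_nonneg fun x => sq_nonneg _
  have hdiss : ε / 2 * ∑ k, d k ≤ Bh := hB ω₂ lam β γ T ε hω hl hβ hγ hT L hL g hg2 hgL hpde
  have hsum0 : 0 ≤ ∑ k, d k := Finset.sum_nonneg fun k _ => hd0 k
  have hBh0 : 0 ≤ Bh := le_trans (by positivity) hdiss
  have hD : ∑ k, d k ≤ 2 * Bh / ε := by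
    rw [le_div_iff₀ hε]
    nlinarith
  -- flip invariance of `μ`
  have hflip : ∀ k : Fin L, MeasurePreserving (momentumFlip k) μ μ := fun k =>
    P.measurePreserving_momentumFlip_gibbsMeasure L T k
  -- per bond: `(γ B̂)² ≤ (M/8)(d_i + d_{i+1})`
  have hbond : ∀ (i j : Fin L), j.val = i.val + 1 → (γ * Bh) ^ 2 ≤ M / 8 * (d i + d j) := by
    intro i j hij
    have hij' : i.val + 1 < L := hij ▸ j.isLt
    have hne : j ≠ i := fun h => by have := congrArg Fin.val h; omega
    -- the identity (a)
    have hid : ∫ x, g x * P.bondCurrent L i x ∂μ = γ * A - T ^ 2 :=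
      hA ω₂ lam β γ T ε hω hl hβ hγ hT L hL g hg2 hgL hpde i hij'
    -- closed form of the bond current
    set a : PhaseSpace L → ℝ := fun x => x.2 i * deriv P.V (x.1 j - x.1 i) with ha
    set b : PhaseSpace L → ℝ := fun x => x.2 j * deriv P.V (x.1 j - x.1 i) with hb
    have hj_eq : ∀ x, P.bondCurrent L i x = -(1 / 2) * (a x + b x) := by
      intro x
      unfold OscillatorChain.bondCurrent
      rw [Finset.sum_eq_single j]
      · rw [if_pos hij]; simp only [ha, hb]; ring
      · intro j' _ hj'
        rw [if_neg]
        intro hv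
        exact hj' (Fin.ext (by omega))
      · intro h; exact absurd (Finset.mem_univ j) h
    -- the half currents: `L²` bounds (c) and oddness
    obtain ⟨⟨haL, haM⟩, ⟨hbL, hbM⟩⟩ := hM L i j hij
    have hodd_a : ∀ x, a (momentumFlip i x) = -a x := by
      intro x
      simp only [ha, momentumFlip_fst, momentumFlip_snd_self]
      ring
    have hodd_b : ∀ x, b (momentumFlip j x) = -b x := by
      intro x
      simp only [hb, momentumFlip_fst, momentumFlip_snd_self]
      ring
    have hca := sq_integral_mul_le_of_odd (hflip i) hgL haL hodd_a
    have hcb := sq_integral_mul_le_of_odd (hflip j) hgL hbL hodd_b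
    -- `∫ g j_i = -(1/2)(∫ g a + ∫ g b)`
    have hsplit : ∫ x, g x * P.bondCurrent L i x ∂μ =
        -(1 / 2) * ((∫ x, g x * a x ∂μ) + ∫ x, g x * b x ∂μ) := by
      have e : (fun x => g x * P.bondCurrent L i x) = fun x => -(1 / 2) * (g x * a x + g x * b x) := by
        funext x; rw [hj_eq x]; ring
      have i1 : Integrable (fun x => g x * a x) μ := hgL.integrable_mul haL
      have i2 : Integrable (fun x => g x * b x) μ := hgL.integrable_mul hbL
      rw [e, integral_const_mul, integral_add i1 i2]
    -- combine: `(γ B̂)² = (∫ g j_i)² ≤ ½((∫ g a)² + (∫ g b)²) ≤ (M/8)(d_i + d_j)`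
    have e1 : (γ * Bh) ^ 2 = (∫ x, g x * P.bondCurrent L i x ∂μ) ^ 2 := by
      rw [hid, hBh]; field_simp; ring
    have hIa : (∫ x, g x * a x ∂μ) ^ 2 ≤ 1 / 4 * d i * M := by
      refine hca.trans ?_
      have : 0 ≤ 1 / 4 * d i := by have := hd0 i; positivity
      simpa only [hd] using mul_le_mul_of_nonneg_left haM this
    have hIb : (∫ x, g x * b x ∂μ) ^ 2 ≤ 1 / 4 * d j * M := by
      refine hcb.trans ?_
      have : 0 ≤ 1 / 4 * d j := by have := hd0 j; positivity
      simpa only [hd] using mul_le_mul_of_nonneg_left hbM this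
    rw [e1, hsplit]
    nlinarith [hIa, hIb, sq_nonneg ((∫ x, g x * a x ∂μ) - ∫ x, g x * b x ∂μ)]
  -- sum over the `L - 1` bonds: `(L-1)(γ B̂)² ≤ (M/8)·2·Σ_k d_k`
  have hcount : ((L : ℝ) - 1) * (γ * Bh) ^ 2 ≤ M / 8 * (2 * ∑ k, d k) := by
    -- reindex through `ℕ`
    set e : ℕ → ℝ := fun n => if h : n < L then d ⟨n, h⟩ else 0 with he
    have he0 : ∀ n, 0 ≤ e n := fun n => by
      simp only [he]; split_ifs with h
      · exact hd0 _
      · exact le_rfl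
    have hsumE : ∑ n ∈ Finset.range L, e n = ∑ k, d k := by
      rw [← Fin.sum_univ_eq_sum_range]
      refine Finset.sum_congr rfl fun k _ => ?_
      simp only [he, dif_pos k.isLt]
    obtain ⟨m, rfl⟩ : ∃ m, L = m + 1 := ⟨L - 1, by omega⟩
    have hstep : ∀ n ∈ Finset.range m, (γ * Bh) ^ 2 ≤ M / 8 * (e n + e (n + 1)) := by
      intro n hn
      rw [Finset.mem_range] at hn
      have h1 : n < m + 1 := by omega
      have h2 : n + 1 < m + 1 := by omega
      have := hbond ⟨n, h1⟩ ⟨n + 1, h2⟩ rfl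
      simpa only [he, dif_pos h1, dif_pos h2] using this
    have hS := Finset.sum_le_sum hstep
    rw [Finset.sum_const, Finset.card_range, nsmul_eq_mul] at hS
    have hsplit1 : ∑ n ∈ Finset.range m, (e n + e (n + 1)) ≤ 2 * ∑ n ∈ Finset.range (m + 1), e n := by
      rw [Finset.sum_add_distrib, two_mul]
      refine add_le_add ?_ ?_
      · rw [Finset.sum_range_succ]
        linarith [he0 m]
      · rw [Finset.sum_range_succ']
        linarith [he0 0]
    have hm : ((m + 1 : ℕ) : ℝ) - 1 = (m : ℝ) := by push_cast; ring
    rw [hm, ← hsumE]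
    calc (m : ℝ) * (γ * Bh) ^ 2 ≤ ∑ n ∈ Finset.range m, M / 8 * (e n + e (n + 1)) := hS
      _ = M / 8 * ∑ n ∈ Finset.range m, (e n + e (n + 1)) := by rw [Finset.mul_sum]
      _ ≤ M / 8 * (2 * ∑ n ∈ Finset.range (m + 1), e n) :=
          mul_le_mul_of_nonneg_left hsplit1 (by positivity)
  -- conclude
  have hL1 : (1 : ℝ) ≤ (L : ℝ) - 1 := by
    have : (2 : ℝ) ≤ L := by exact_mod_cast hL
    linarith
  have hmain : ((L : ℝ) - 1) * γ ^ 2 * Bh ≤ M / (2 * ε) := by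
    -- from `(L-1)γ²B̂² ≤ (M/4)Σd ≤ (M/4)(2B̂/ε)`; divide by `B̂` when positive
    have h1 : ((L : ℝ) - 1) * γ ^ 2 * Bh ^ 2 ≤ M / (2 * ε) * Bh := by
      have h2 : ((L : ℝ) - 1) * (γ * Bh) ^ 2 ≤ M / 8 * (2 * (2 * Bh / ε)) :=
        hcount.trans (mul_le_mul_of_nonneg_left (by linarith) (by positivity))
      have h3 : M / 8 * (2 * (2 * Bh / ε)) = M / (2 * ε) * Bh := by field_simp; ring
      nlinarith [h2, h3]
    rcases hBh0.eq_or_lt with h0 | hpos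
    · have hz : ((L : ℝ) - 1) * γ ^ 2 * Bh = 0 := by rw [← h0]; ring
      rw [hz]; positivity
    · exact le_of_mul_le_mul_right (by nlinarith [h1]) hpos
  have hgoal : ((L : ℝ) - 1) * (γ * (1 - γ / T ^ 2 * A)) = ((L : ℝ) - 1) * γ ^ 2 * Bh / T ^ 2 := by
    rw [hBh]; field_simp
  rw [hgoal, div_le_div_iff₀ (by positivity) (by positivity)]
  calc ((L : ℝ) - 1) * γ ^ 2 * Bh * (2 * ε * T ^ 2) = (((L : ℝ) - 1) * γ ^ 2 * Bh) * (2 * ε) * T ^ 2 := by ring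
    _ ≤ M / (2 * ε) * (2 * ε) * T ^ 2 := by gcongr
    _ = M * T ^ 2 := by field_simp

/-- **The field ceiling** (closed form: `fieldCeiling_of` applied to the three landed helpers): for all admissible
parameters, `T > 0`, `ε > 0` there is `K` with `(L − 1)·γ(1 − (γ/T²)⟨g, p_0² − T⟩_{μ_T}) ≤ K` for every `L ≥ 2`
and every classical `C² ∩ L²(μ_T)` forward field `g` of `L_{T,T} + εS` with source `−(p_0² − T)`.
[cite: BernardinOlla2011, §3] -/
theorem fieldCeiling :
    ∀ (ω₂ lam β γ T ε : ℝ), 0 < ω₂ → 0 < lam → 0 < β → 0 < γ → 0 < T → 0 < ε → ∃ K : ℝ,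
      ∀ (L : ℕ), 2 ≤ L → ∀ g : PhaseSpace L → ℝ, ContDiff ℝ 2 g →
        MemLp g 2 ((pinnedChain ω₂ lam β γ).gibbsMeasure L T) →
        (∀ x, (pinnedChain ω₂ lam β γ).flipGenerator L T T ε g x = -(kin L 0 x - T)) →
        ((L : ℝ) - 1) * (γ * (1 - γ / T ^ 2 *
          ∫ x, g x * (kin L 0 x - T) ∂((pinnedChain ω₂ lam β γ).gibbsMeasure L T))) ≤ K :=
  fieldCeiling_of helper_flipBondResponseIdentity helper_flipFieldDissipationLe helper_gibbsHalfCurrentSqLe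

/-- Registered helper `helper_flipFieldCeiling` of stub `stub_flipConductanceCeiling` (line `sector-dirichlet-gluing`,
crux stmt-AtomisticToContinuum-11977): notation-free restatement of `fieldCeiling`. -/
theorem helper_flipFieldCeiling : ∀ (ω₂ lam β γ T ε : ℝ), 0 < ω₂ → 0 < lam → 0 < β → 0 < γ → 0 < T → 0 < ε → ∃ K : ℝ, ∀ (L : ℕ), 2 ≤ L → ∀ g : Literature.MathematicalPhysics.KineticTheory.HeatConduction.PhaseSpace L → ℝ, ContDiff ℝ 2 g → MeasureTheory.MemLp g 2 ((Literature.MathematicalPhysics.KineticTheory.HeatConduction.pinnedChain ω₂ lam β γ).gibbsMeasure L T) → (∀ x, (Literature.MathematicalPhysics.KineticTheory.HeatConduction.pinnedChain ω₂ lam β γ).flipGenerator L T T ε g x = -(Summit.AtomisticToContinuum.FouriersLaw.Theorems.SuperadditiveResistance.DeviceLiouville.kin L 0 x - T)) → ((L : ℝ) - 1) * (γ * (1 - γ / T ^ 2 * MeasureTheory.integral ((Literature.MathematicalPhysics.KineticTheory.HeatConduction.pinnedChain ω₂ lam β γ).gibbsMeasure L T) (fun x => g x * (Summit.AtomisticToContinuum.FouriersLaw.Theorems.SuperadditiveResistance.DeviceLiouville.kin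 L 0 x - T)))) ≤ K :=
  fieldCeiling

end Summit.AtomisticToContinuum.FouriersLaw.Theorems.NoisyFourier.FlipCeiling

end
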